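import Literature.Combinatorics.LorentzianPolynomials.MatroidBases
import Mathlib.Combinatorics.Matroid.IndepAxioms
import HarnessLib

/-!
# The basis generating polynomial of a Mathlib `Matroid` on a finite type is Lorentzian, and conversely an M-convex
# family of `0/1` vectors is the set of bases of a matroid (Brändén–Huh 2020, §2.2 p. 11 and §3.2 Thm. 3.10 (7) ⟺ (8);
# Anari–Liu–Oveis Gharan–Vinzant)

Layer `Literature/Combinatorics/LorentzianPolynomials`, namespace `Literature.Combinatorics.LorentzianPolynomials`;
lane `lit-hodgefound` (Track 2 foundations library), seat p16, generation 27 (rows g27-#12, §§1–3, and g27-#13, §4). A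
bridge between Mathlib's matroid library (`Matroid σ`, `Matroid.IsBase`, `Matroid.IsBase.exchange`,
`Matroid.IsBase.ncard_eq_ncard_of_isBase`, `Matroid.ofIsBaseOfFinite`, `Matroid.ExchangeProperty`) and row g27-#10
(`MatroidBases.lean`: `genPoly_mem_lorentzian` — an M-convex `J ⊆ {0,1}^σ ∩ Δ^d` has Lorentzian generating polynomial).

## Source (verbatim) — P. Brändén, J. Huh, *Lorentzian polynomials* [BrandenHuh2019] (held `paper:arxiv-1902.03719`)

* §2.2 (p. 11): "A matroid `M` on `[n]` is a nonempty family of subsets `B` of `[n]`, called the set of bases of `M`, that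
  satisfies the exchange property: For any `B_1, B_2 ∈ B` and `i ∈ B_1 ∖ B_2`, there is `j ∈ B_2 ∖ B_1` such that
  `(B_1 ∖ i) ∪ j ∈ B`." — this is Mathlib's `Matroid.IsBase.exchange` — and "The restriction of [M-convexity] to the subsets
  of `{0,1}^n` gives the family of matroids on `[n]`."
* §1 (p. 5) and §3.2 Thm. 3.10: "the basis generating polynomial of any matroid is Lorentzian" (there attributed to
  [ALOGV18] = Anari–Liu–Oveis Gharan–Vinzant; Thm. 3.10 proves `J` M-convex ⟺ its normalized generating polynomial is
  Lorentzian, and for `J ⊆ {0,1}^n` the normalized and plain generating polynomials coincide).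
* §3.2 Thm. 3.10: "The following are equivalent for any nonempty `J ⊆ ℕ^n`. (1) There is a Lorentzian polynomial whose
  support is `J`. […] (4) The generating function `f_J` is a Lorentzian polynomial. […] (7) `J` is M-convex. When
  `J ⊆ {0,1}^n`, any one of the above conditions is equivalent to (8) `J` is the set of bases of a matroid on `[n]`."

## What is here (`σ` a finite type, `M : Matroid σ`)

* `indSet B = e_B ∈ {0,1}^σ` for `B : Set σ` (`indSet_apply`, `indSet_le_one`, `indSet_ne_zero_iff`, `degree_indSet = #B`,
  `indSet_injective`, `indSet_insert_diff : e_{(B ∖ e) ∪ y} = e_B - e_e + e_y`);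
* `basesExp M` = the finite set `{e_B : B a base of M}` (`mem_basesExp`) and **`isMConvex_basesExp`**: Mathlib's basis
  exchange axiom is the exchange property (M-convexity) of `{e_B}`;
* `basisGenPoly M = Σ_{B base} w^{e_B}` (`basisGenPoly_def`, `coeff_basisGenPoly`, `coeff_basisGenPoly_indSet`) and
  **`basisGenPoly_mem_lorentzian`**: `basisGenPoly M ∈ L^r_σ`, `r = #B₀` the common size of the bases;
* §4, conversely (Thm. 3.10 (7) ⟹ (8)): `IsMConvex.exchangeProperty_indSet_mem` (M-convexity of `J ⊆ {0,1}^σ` is Mathlib's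
  `Matroid.ExchangeProperty` of `B ↦ e_B ∈ J`), the matroid **`IsMConvex.matroid`** of a nonempty M-convex `J ⊆ {0,1}^σ`
  (`matroid_isBase_iff : IsBase B ↔ e_B ∈ J`, `basesExp_matroid = J`, `basisGenPoly_matroid = genPoly J`,
  `matroid_basesExp_isBase_iff`), and the printed equivalences for nonempty `J ⊆ {0,1}^σ` (`∩ Δ^d`):
  **`isMConvex_iff_exists_basesExp_eq`** ((7) ⟺ (8)), `genPoly_mem_lorentzian_iff_exists_basesExp_eq` ((4) ⟺ (8)),
  `exists_support_eq_iff_exists_basesExp_eq` ((1) ⟺ (8)).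

Four definitions with bodies (`indSet`, `basesExp`, `basisGenPoly`, `IsMConvex.matroid`), theorems otherwise; no `sorry`,
no named fact.

## References

* [BrandenHuh2019] P. Brändén, J. Huh, *Lorentzian polynomials*, Ann. of Math. (2) 192 (2020) 821–891, arXiv:1902.03719 —
  §1 (p. 5), §2.2 (p. 11), §3.2 Thm. 3.10.
-/

noncomputable section

open MvPolynomial Finsupp Finset
open scoped Nat

namespace Literature.Combinatorics.LorentzianPolynomials

variable {σ : Type*} [Fintype σ]

/-! ## §1 Subsets of a finite type as `0/1` exponents -/

section IndSet

/-- **The `0/1` exponent `e_B` of a subset `B ⊆ σ`** of a finite type: `(e_B)_i = [i ∈ B]` (the exponent `ind` of the finite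
set `B`). [cite: BrandenHuh2019, §2.2 (p. 11, "the subsets of `{0,1}^n`")] -/
def indSet (B : Set σ) : σ →₀ ℕ := ind (Set.toFinite B).toFinset

/-- `e_B = ind B.toFinset`. [cite: BrandenHuh2019, §2.2 (p. 11)] -/
theorem indSet_def (B : Set σ) : indSet B = ind (Set.toFinite B).toFinset := rfl

/-- `(e_B)_i = [i ∈ B]`. [cite: BrandenHuh2019, §2.2 (p. 11)] -/
theorem indSet_apply (B : Set σ) (i : σ) [Decidable (i ∈ B)] : indSet B i = if i ∈ B then 1 else 0 := by
  classical
  rw [indSet, ind_apply]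
  by_cases h : i ∈ B
  · rw [if_pos ((Set.Finite.mem_toFinset _).2 h), if_pos h]
  · rw [if_neg (fun h' ↦ h ((Set.Finite.mem_toFinset _).1 h')), if_neg h]

/-- `(e_B)_i ≤ 1`. [cite: BrandenHuh2019, §2.2 (p. 11)] -/
theorem indSet_le_one (B : Set σ) (i : σ) : indSet B i ≤ 1 :=
  ind_le_one _ i

/-- `(e_B)_i ≠ 0 ⟺ i ∈ B`. [cite: BrandenHuh2019, §2.2 (p. 11)] -/
theorem indSet_ne_zero_iff (B : Set σ) (i : σ) : indSet B i ≠ 0 ↔ i ∈ B := by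
  classical
  rw [indSet_apply]
  split_ifs with h <;> simp [h]

/-- `(e_B)_i = 0 ⟺ i ∉ B`. [cite: BrandenHuh2019, §2.2 (p. 11)] -/
theorem indSet_eq_zero_iff (B : Set σ) (i : σ) : indSet B i = 0 ↔ i ∉ B := by
  rw [← indSet_ne_zero_iff, not_not]

/-- `supp e_B = B`. [cite: BrandenHuh2019, §2.2 (p. 11)] -/
theorem coe_support_indSet (B : Set σ) : ((indSet B).support : Set σ) = B := by
  rw [indSet, support_ind, Set.Finite.coe_toFinset]

/-- `B ↦ e_B` is injective. [cite: BrandenHuh2019, §2.2 (p. 11)] -/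
theorem indSet_injective : Function.Injective (indSet : Set σ → σ →₀ ℕ) := fun B B' h ↦ by
  rw [← coe_support_indSet B, h, coe_support_indSet]

/-- `|e_B| = #B`. [cite: BrandenHuh2019, §2.2 (p. 11)] -/
theorem degree_indSet (B : Set σ) : (indSet B).degree = B.ncard := by
  rw [indSet, degree_ind, Set.ncard_eq_toFinset_card B (Set.toFinite B)]

/-- **The exchange `(B ∖ e) ∪ y` on exponents**: `e_{(B ∖ e) ∪ y} = e_B - e_e + e_y` for `e ∈ B`, `y ∉ B`.
[cite: BrandenHuh2019, §2.2 (p. 11, "`(B_1 ∖ i) ∪ j`" and "`α - e_i + e_j`")] -/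
theorem indSet_insert_diff {B : Set σ} {e y : σ} (he : e ∈ B) (hy : y ∉ B) :
    indSet (insert y (B \ {e})) = indSet B - Finsupp.single e 1 + Finsupp.single y 1 := by
  classical
  have hye : y ≠ e := fun h ↦ hy (h ▸ he)
  ext k
  simp only [indSet_apply, Finsupp.add_apply, Finsupp.tsub_apply, Finsupp.single_apply, Set.mem_insert_iff, Set.mem_sdiff,
    Set.mem_singleton_iff]
  by_cases hky : k = y
  · subst hky
    simp [hy, hye.symm]
  · by_cases hke : k = e
    · subst hke
      simp [he, hky, Ne.symm hky]
    · by_cases hkB : k ∈ B <;> simp [hkB, hky, hke, Ne.symm hky, Ne.symm hke]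

end IndSet

/-! ## §2 The bases of a matroid form an M-convex set -/

section Bases

/-- **The exponents of the bases** of a matroid `M` on the finite type `σ`: the finite set `{e_B : B a base of M}` (the image of
the finite family of bases under `B ↦ e_B`). [cite: BrandenHuh2019, §2.2 (p. 11, "the set of bases of `M`")] -/
def basesExp (M : Matroid σ) : Finset (σ →₀ ℕ) :=
  ((Set.toFinite {B : Set σ | M.IsBase B}).image indSet).toFinset

/-- `α ∈ basesExp M ⟺ α = e_B` for some base `B` of `M`. [cite: BrandenHuh2019, §2.2 (p. 11)] -/
theorem mem_basesExp {M : Matroid σ} {α : σ →₀ ℕ} : α ∈ basesExp M ↔ ∃ B, M.IsBase B ∧ indSet B = α := by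
  rw [basesExp, Set.Finite.mem_toFinset, Set.mem_image]
  rfl

/-- `e_B ∈ basesExp M ⟺ B` is a base of `M`. [cite: BrandenHuh2019, §2.2 (p. 11)] -/
theorem indSet_mem_basesExp {M : Matroid σ} {B : Set σ} : indSet B ∈ basesExp M ↔ M.IsBase B := by
  rw [mem_basesExp]
  constructor
  · rintro ⟨B', hB', h⟩
    rwa [← indSet_injective h]
  · exact fun h ↦ ⟨B, h, rfl⟩

/-- The exponents of the bases are squarefree: `α_i ≤ 1` for `α ∈ basesExp M`. [cite: BrandenHuh2019, §2.2 (p. 11)] -/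
theorem le_one_of_mem_basesExp {M : Matroid σ} {α : σ →₀ ℕ} (hα : α ∈ basesExp M) (i : σ) : α i ≤ 1 := by
  obtain ⟨B, -, rfl⟩ := mem_basesExp.1 hα
  exact indSet_le_one B i

/-- The exponents of the bases all have degree the rank: `|α| = #B₀` for `α ∈ basesExp M` and any base `B₀` (Mathlib's
`Matroid.IsBase.ncard_eq_ncard_of_isBase`). [cite: BrandenHuh2019, §2.2 (p. 11)] -/
theorem degree_eq_of_mem_basesExp {M : Matroid σ} {B₀ : Set σ} (hB₀ : M.IsBase B₀) {α : σ →₀ ℕ} (hα : α ∈ basesExp M) :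
    α.degree = B₀.ncard := by
  obtain ⟨B, hB, rfl⟩ := mem_basesExp.1 hα
  rw [degree_indSet, hB.ncard_eq_ncard_of_isBase hB₀]

/-- **Mathlib's basis exchange axiom is the exchange property (M-convexity) of `{e_B : B a base}`**: "For any `B_1, B_2 ∈ B`
and `i ∈ B_1 ∖ B_2`, there is `j ∈ B_2 ∖ B_1` such that `(B_1 ∖ i) ∪ j ∈ B`", i.e. "The restriction of [M-convexity] to the
subsets of `{0,1}^n` gives the family of matroids on `[n]`". [cite: BrandenHuh2019, §2.2 (p. 11)] -/
theorem isMConvex_basesExp (M : Matroid σ) : IsMConvex ((basesExp M : Finset (σ →₀ ℕ)) : Set (σ →₀ ℕ)) := by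
  intro α β hα hβ i hi
  rw [Finset.mem_coe, mem_basesExp] at hα hβ
  obtain ⟨B₁, hB₁, rfl⟩ := hα
  obtain ⟨B₂, hB₂, rfl⟩ := hβ
  -- `i ∈ B₁ ∖ B₂` since `(e_{B₂})_i < (e_{B₁})_i ≤ 1`
  have hi1 : i ∈ B₁ := (indSet_ne_zero_iff B₁ i).1 (by omega)
  have hi2 : i ∉ B₂ := fun h ↦ by
    have h1 := indSet_le_one B₁ i
    have h2 : indSet B₂ i ≠ 0 := (indSet_ne_zero_iff B₂ i).2 h
    omega
  obtain ⟨y, ⟨hy2, hy1⟩, hB⟩ := hB₁.exchange hB₂ ⟨hi1, hi2⟩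
  refine ⟨y, ?_, ?_⟩
  · have h1 : indSet B₁ y = 0 := (indSet_eq_zero_iff B₁ y).2 hy1
    have h2 : indSet B₂ y ≠ 0 := (indSet_ne_zero_iff B₂ y).2 hy2
    omega
  · rw [← indSet_insert_diff hi1 hy1, Finset.mem_coe, mem_basesExp]
    exact ⟨_, hB, rfl⟩

end Bases

/-! ## §3 The basis generating polynomial is Lorentzian -/

section BasisGenPoly

/-- **The basis generating polynomial `Σ_{B base of M} Π_{i ∈ B} w_i`** of a matroid on a finite type (the generating
polynomial `genPoly` of the exponents of its bases). [cite: BrandenHuh2019, §1 (p. 5, "the basis generating polynomial of any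
matroid"); §3.2 Thm. 3.10] -/
def basisGenPoly (M : Matroid σ) : MvPolynomial σ ℝ := genPoly (basesExp M)

/-- `basisGenPoly M = Σ_{α ∈ basesExp M} w^α`. [cite: BrandenHuh2019, §3.2 Thm. 3.10] -/
theorem basisGenPoly_def (M : Matroid σ) : basisGenPoly M = ∑ α ∈ basesExp M, monomial α 1 := rfl

variable [DecidableEq σ]

/-- The coefficients of the basis generating polynomial: `coeff_α = [α ∈ basesExp M]`. [cite: BrandenHuh2019, §3.2 Thm. 3.10]
-/
theorem coeff_basisGenPoly (M : Matroid σ) (α : σ →₀ ℕ) :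
    coeff α (basisGenPoly M) = if α ∈ basesExp M then 1 else 0 := by
  rw [basisGenPoly, coeff_genPoly]

/-- `coeff_{e_B} = [B is a base]`. [cite: BrandenHuh2019, §3.2 Thm. 3.10] -/
theorem coeff_basisGenPoly_indSet (M : Matroid σ) (B : Set σ) [Decidable (M.IsBase B)] :
    coeff (indSet B) (basisGenPoly M) = if M.IsBase B then 1 else 0 := by
  rw [coeff_basisGenPoly]
  exact if_congr indSet_mem_basesExp rfl rfl

/-- The support of the basis generating polynomial is the set of exponents of bases. [cite: BrandenHuh2019, §3.2 Thm. 3.10] -/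
theorem support_basisGenPoly (M : Matroid σ) :
    {β : σ →₀ ℕ | coeff β (basisGenPoly M) ≠ 0} = (basesExp M : Set (σ →₀ ℕ)) :=
  support_genPoly _

/-- **The basis generating polynomial of a matroid on a finite type is Lorentzian**: `basisGenPoly M ∈ L^r_σ` where `r = #B₀`
is the size of any base `B₀` (all bases have the same size). [cite: BrandenHuh2019, §1 (p. 5, "the basis generating
polynomial of any matroid is Lorentzian" [ALOGV18]); §3.2 Thm. 3.10; §2.2 (p. 11)] -/
theorem basisGenPoly_mem_lorentzian (M : Matroid σ) {B₀ : Set σ} (hB₀ : M.IsBase B₀) :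
    basisGenPoly M ∈ lorentzian σ B₀.ncard :=
  genPoly_mem_lorentzian (fun _ hα i ↦ le_one_of_mem_basesExp hα i) (fun _ hα ↦ degree_eq_of_mem_basesExp hB₀ hα)
    (isMConvex_basesExp M)

/-- Base-free form: `basisGenPoly M ∈ L^r_σ` for some `r` (every matroid has a base — Mathlib's `Matroid.exists_isBase` — and
`r` is its size, the rank of `M`). [cite: BrandenHuh2019, §1 (p. 5); §3.2 Thm. 3.10] -/
theorem exists_basisGenPoly_mem_lorentzian (M : Matroid σ) : ∃ r, basisGenPoly M ∈ lorentzian σ r := by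
  obtain ⟨B₀, hB₀⟩ := M.exists_isBase
  exact ⟨_, basisGenPoly_mem_lorentzian M hB₀⟩

end BasisGenPoly

/-! ## §4 Conversely: a nonempty M-convex family of `0/1` vectors is the set of bases of a matroid
(Brändén–Huh Thm. 3.10 (7) ⟺ (8)) -/

section OfMConvex

/-- `e_{supp α} = α` for a squarefree exponent `α ∈ {0,1}^σ`. [cite: BrandenHuh2019, §2.2 (p. 11)] -/
theorem indSet_coe_support {α : σ →₀ ℕ} (h : ∀ i, α i ≤ 1) : indSet (α.support : Set σ) = α := by
  rw [indSet, Set.Finite.toFinset_eq_toFinset, Finset.toFinset_coe, ← eq_ind_support h]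

/-- **The exchange property of `{e_B} ⊆ {0,1}^σ` M-convex is Mathlib's basis exchange axiom** for the predicate
`B ↦ e_B ∈ J`. [cite: BrandenHuh2019, §2.2 (p. 11, "the exchange property: For any `B_1, B_2 ∈ B` and `i ∈ B_1 ∖ B_2`,
there is `j ∈ B_2 ∖ B_1` such that `(B_1 ∖ i) ∪ j ∈ B`")] -/
theorem IsMConvex.exchangeProperty_indSet_mem {J : Set (σ →₀ ℕ)} (hM : IsMConvex J) :
    Matroid.ExchangeProperty (fun B : Set σ ↦ indSet B ∈ J) := by
  intro B₁ B₂ hB₁ hB₂ a ha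
  rw [Set.mem_sdiff] at ha
  have h1 : indSet B₁ a ≠ 0 := (indSet_ne_zero_iff B₁ a).2 ha.1
  have h2 : indSet B₂ a = 0 := (indSet_eq_zero_iff B₂ a).2 ha.2
  obtain ⟨j, hj, hJ⟩ := hM hB₁ hB₂ a (by omega)
  have hj1 : j ∉ B₁ := fun h ↦ by
    have h3 : indSet B₁ j ≠ 0 := (indSet_ne_zero_iff B₁ j).2 h
    have h4 := indSet_le_one B₂ j
    omega
  have hj2 : j ∈ B₂ := (indSet_ne_zero_iff B₂ j).1 (by omega)
  refine ⟨j, Set.mem_sdiff_of_mem hj2 hj1, ?_⟩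
  change indSet (insert j (B₁ \ {a})) ∈ J
  rwa [indSet_insert_diff ha.1 hj1]

/-- **The matroid of a nonempty M-convex `J ⊆ {0,1}^σ`**: the matroid on the (finite) ground set `σ` whose bases are the
`B ⊆ σ` with `e_B ∈ J` (Mathlib's `Matroid.ofIsBaseOfFinite` fed with the exchange property of `J`).
[cite: BrandenHuh2019, §3.2 Thm. 3.10 ((7) ⟹ (8)); §2.2 (p. 11, "The restriction of [M-convexity] to the subsets of `{0,1}^n`
gives the family of matroids on `[n]`")] -/
def IsMConvex.matroid {J : Finset (σ →₀ ℕ)} (hM : IsMConvex (J : Set (σ →₀ ℕ))) (hJ01 : ∀ α ∈ J, ∀ i, α i ≤ 1)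
    (hne : J.Nonempty) : Matroid σ :=
  Matroid.ofIsBaseOfFinite Set.finite_univ (fun B : Set σ ↦ indSet B ∈ (J : Set (σ →₀ ℕ)))
    (by
      obtain ⟨α, hα⟩ := hne
      exact ⟨(α.support : Set σ), by rwa [indSet_coe_support (hJ01 α hα), Finset.mem_coe]⟩)
    hM.exchangeProperty_indSet_mem (fun B _ ↦ Set.subset_univ B)

/-- The ground set of the matroid of `J` is all of `σ`. [cite: BrandenHuh2019, §3.2 Thm. 3.10] -/
theorem IsMConvex.matroid_E {J : Finset (σ →₀ ℕ)} (hM : IsMConvex (J : Set (σ →₀ ℕ))) (hJ01 : ∀ α ∈ J, ∀ i, α i ≤ 1)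
    (hne : J.Nonempty) : (hM.matroid hJ01 hne).E = Set.univ := rfl

/-- **The bases of the matroid of `J` are the `B` with `e_B ∈ J`.** [cite: BrandenHuh2019, §3.2 Thm. 3.10 ((7) ⟹ (8))] -/
theorem IsMConvex.matroid_isBase_iff {J : Finset (σ →₀ ℕ)} (hM : IsMConvex (J : Set (σ →₀ ℕ)))
    (hJ01 : ∀ α ∈ J, ∀ i, α i ≤ 1) (hne : J.Nonempty) {B : Set σ} : (hM.matroid hJ01 hne).IsBase B ↔ indSet B ∈ J := by
  rw [IsMConvex.matroid, Matroid.ofIsBaseOfFinite_isBase, Finset.mem_coe]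

/-- The exponents of the bases of the matroid of `J` are `J` itself. [cite: BrandenHuh2019, §3.2 Thm. 3.10 ((7) ⟹ (8))] -/
theorem IsMConvex.basesExp_matroid {J : Finset (σ →₀ ℕ)} (hM : IsMConvex (J : Set (σ →₀ ℕ)))
    (hJ01 : ∀ α ∈ J, ∀ i, α i ≤ 1) (hne : J.Nonempty) : basesExp (hM.matroid hJ01 hne) = J := by
  ext α
  rw [mem_basesExp]
  constructor
  · rintro ⟨B, hB, rfl⟩
    exact (hM.matroid_isBase_iff hJ01 hne).1 hB
  · intro hα
    refine ⟨(α.support : Set σ), ?_, indSet_coe_support (hJ01 α hα)⟩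
    rw [hM.matroid_isBase_iff hJ01 hne, indSet_coe_support (hJ01 α hα)]
    exact hα

/-- The basis generating polynomial of the matroid of `J` is the generating polynomial `Σ_{α ∈ J} w^α` of `J`.
[cite: BrandenHuh2019, §3.2 Thm. 3.10] -/
theorem IsMConvex.basisGenPoly_matroid {J : Finset (σ →₀ ℕ)} (hM : IsMConvex (J : Set (σ →₀ ℕ)))
    (hJ01 : ∀ α ∈ J, ∀ i, α i ≤ 1) (hne : J.Nonempty) : basisGenPoly (hM.matroid hJ01 hne) = genPoly J := by
  rw [basisGenPoly, hM.basesExp_matroid hJ01 hne]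

/-- **Brändén–Huh Thm. 3.10, (7) ⟺ (8)**: "When `J ⊆ {0,1}^n` [is nonempty], [`J` is M-convex] is equivalent to (8) `J` is the
set of bases of a matroid on `[n]`" — here with Mathlib's `Matroid σ` and `basesExp M = {e_B : B a base of M}`.
[cite: BrandenHuh2019, §3.2 Thm. 3.10] -/
theorem isMConvex_iff_exists_basesExp_eq {J : Finset (σ →₀ ℕ)} (hJ01 : ∀ α ∈ J, ∀ i, α i ≤ 1) (hne : J.Nonempty) :
    IsMConvex (J : Set (σ →₀ ℕ)) ↔ ∃ M : Matroid σ, basesExp M = J := by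
  constructor
  · exact fun hM ↦ ⟨hM.matroid hJ01 hne, hM.basesExp_matroid hJ01 hne⟩
  · rintro ⟨M, rfl⟩
    exact isMConvex_basesExp M

/-- Every matroid on a finite type is the matroid of the (M-convex) set of exponents of its bases: the bases of
`(isMConvex_basesExp M).matroid` are the bases of `M`. [cite: BrandenHuh2019, §3.2 Thm. 3.10; §2.2 (p. 11)] -/
theorem matroid_basesExp_isBase_iff (M : Matroid σ) {B : Set σ} :
    ((isMConvex_basesExp M).matroid (fun _ hα i ↦ le_one_of_mem_basesExp hα i)
      (let ⟨B₀, hB₀⟩ := M.exists_isBase; ⟨indSet B₀, indSet_mem_basesExp.2 hB₀⟩)).IsBase B ↔ M.IsBase B := by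
  rw [IsMConvex.matroid_isBase_iff, indSet_mem_basesExp]

variable [DecidableEq σ]

/-- **Brändén–Huh Thm. 3.10, (4) ⟺ (8)** for `J ⊆ {0,1}^n ∩ Δ^d_n` nonempty: the generating polynomial `Σ_{α ∈ J} w^α` (which
is the normalized generating function `f_J`, as `α! = 1` on `{0,1}^n`) is Lorentzian iff `J` is the set of bases of a matroid.
[cite: BrandenHuh2019, §3.2 Thm. 3.10] -/
theorem genPoly_mem_lorentzian_iff_exists_basesExp_eq {J : Finset (σ →₀ ℕ)} {d : ℕ} (hJ01 : ∀ α ∈ J, ∀ i, α i ≤ 1)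
    (hJd : ∀ α ∈ J, α.degree = d) (hne : J.Nonempty) :
    genPoly J ∈ lorentzian σ d ↔ ∃ M : Matroid σ, basesExp M = J := by
  rw [← isMConvex_iff_exists_basesExp_eq hJ01 hne]
  constructor
  · intro h
    rw [← support_genPoly J]
    exact isMConvex_support_of_mem_lorentzian h
  · exact genPoly_mem_lorentzian hJ01 hJd

/-- **Brändén–Huh Thm. 3.10, (1) ⟺ (8)** for `J ⊆ {0,1}^n ∩ Δ^d_n` nonempty: "There is a Lorentzian polynomial whose support is
`J`" iff `J` is the set of bases of a matroid. [cite: BrandenHuh2019, §3.2 Thm. 3.10] -/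
theorem exists_support_eq_iff_exists_basesExp_eq {J : Finset (σ →₀ ℕ)} {d : ℕ} (hJ01 : ∀ α ∈ J, ∀ i, α i ≤ 1)
    (hJd : ∀ α ∈ J, α.degree = d) (hne : J.Nonempty) :
    (∃ f ∈ lorentzian σ d, {β : σ →₀ ℕ | coeff β f ≠ 0} = (J : Set (σ →₀ ℕ))) ↔ ∃ M : Matroid σ, basesExp M = J := by
  rw [← genPoly_mem_lorentzian_iff_exists_basesExp_eq hJ01 hJd hne]
  constructor
  · rintro ⟨f, hf, hsupp⟩
    have hM := isMConvex_support_of_mem_lorentzian hf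
    rw [hsupp] at hM
    exact genPoly_mem_lorentzian hJ01 hJd hM
  · exact fun h ↦ ⟨genPoly J, h, support_genPoly J⟩

end OfMConvex

end Literature.Combinatorics.LorentzianPolynomials

end
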